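import Summits.Ventures.DiscreteObjects.Hadamard.ConferenceGraph333Order33
import Summits.Ventures.DiscreteObjects.Hadamard.ConferenceGraph333Order22RankTest

/-!
# Order `66` in Aut(srg(333,166,82,83)): three admissible cycle types (kernel)

Framing: lottery ticket; floor = certified bounds/negative ranges.  Cell pub-namedobj (venture DiscreteObjects),
target (H) = `H(668)`, hadamard gen 32.  Census COROLLARY of the kernel rank tests: for `σ` of order `66`, `σ²` has order `33`
(`ConferenceGraph333Order33.aut_order33_unique_type`: `#Fix σ² = 1`, `#Fix σ⁶ = 25`, `#Fix σ²² = 45`) and `σ³` has order `22`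
(`ConferenceGraph333Order22RankTest.aut_order22_census`: seven (`#Fix σ³`, `#Fix σ³³`) pairs); with the cycle-length census kit
(`aut_cycle_length_census`: even numbers of cycles of each length `> 1`) this leaves exactly three cycle types,
`66⁴·22²·6⁴·1`, `66⁴·11⁴·6⁴·1`, `66²·33⁴·22²·6²·3⁴·1`:
* **`aut_order66_census`** — `#Fix σ = #Fix σ² = 1`, `#Fix σ⁶ = 25`, `#Fix σ²² = 45`, and
  `(#Fix σ³, #Fix σ¹¹, #Fix σ³³) ∈ {(1, 1, 1), (1, 45, 45), (13, 1, 145)}`.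
E2: pub-namedobj-hadamard-g31/results/rank_test_11_g31.txt (`n = 66`: 9 kit types → 3, the KEEP rows).  WORDS: structure of a HYPOTHETICAL
object (order `66` remains admissible); ours (PROVISIONAL).  No `sorry`, no new definitions.
-/

namespace Summit.Ventures.DiscreteObjects.Hadamard

open Finset

section order66
variable {V : Type*} [Fintype V] [DecidableEq V]

/-- **Order `66`: three admissible cycle types.** -/
theorem aut_order66_census (hV : Fintype.card V = 333) (A : Matrix V V ℤ)
    (h01 : ∀ x y, A x y = 0 ∨ A x y = 1) (hsymm : ∀ x y, A y x = A x y) (hdiag : ∀ x, A x x = 0)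
    (hk : ∀ x, ∑ y, A x y = 166) (hsrg : ∀ x y, ∑ z, A x z * A z y = 83 * (1 + (if x = y then 1 else 0)) - A x y)
    (σ : Equiv.Perm V) (hσ : σ ^ 66 = 1) (hσ33 : σ ^ 33 ≠ 1) (hσ22 : σ ^ 22 ≠ 1) (hσ6 : σ ^ 6 ≠ 1)
    (hA : ∀ x y, A (σ x) (σ y) = A x y) :
    (univ.filter fun x => σ x = x).card = 1 ∧ (univ.filter fun x => (σ ^ 2) x = x).card = 1 ∧
    (univ.filter fun x => (σ ^ 6) x = x).card = 25 ∧ (univ.filter fun x => (σ ^ 22) x = x).card = 45 ∧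
    (((univ.filter fun x => (σ ^ 3) x = x).card = 1 ∧ (univ.filter fun x => (σ ^ 11) x = x).card = 1 ∧
        (univ.filter fun x => (σ ^ 33) x = x).card = 1) ∨
     ((univ.filter fun x => (σ ^ 3) x = x).card = 1 ∧ (univ.filter fun x => (σ ^ 11) x = x).card = 45 ∧
        (univ.filter fun x => (σ ^ 33) x = x).card = 45) ∨
     ((univ.filter fun x => (σ ^ 3) x = x).card = 13 ∧ (univ.filter fun x => (σ ^ 11) x = x).card = 1 ∧
        (univ.filter fun x => (σ ^ 33) x = x).card = 145)) := by
  have hAk := adj_pow_invariant A σ hA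
  obtain ⟨c, h1, h2, -, -, h6⟩ := aut_cycle_length_census hV A h01 hsymm hdiag hk hsrg σ hσ (by norm_num) hA
  have hD : Nat.divisors 66 = {1, 2, 3, 6, 11, 22, 33, 66} := by decide
  have f1 := h2 1
  have f2 := h2 2
  have f3 := h2 3
  have f6 := h2 6
  have f11 := h2 11
  have f22 := h2 22
  have f33 := h2 33
  have e2 := h6 2 (by norm_num)
  have e3 := h6 3 (by norm_num)
  have e6 := h6 6 (by norm_num)
  have e11 := h6 11 (by norm_num)
  have e22 := h6 22 (by norm_num)
  have e33 := h6 33 (by norm_num)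
  have e66 := h6 66 (by norm_num)
  rw [pow_one] at f1
  simp only [hD, Finset.sum_filter] at h1 f1 f2 f3 f6 f11 f22 f33
  norm_num at h1 f1 f2 f3 f6 f11 f22 f33
  -- σ² has order 33: unique type
  have hp2 : (σ ^ 2) ^ 33 = 1 := by rw [← pow_mul]; exact hσ
  have hp2a : (σ ^ 2) ^ 11 ≠ 1 := by rw [← pow_mul]; exact hσ22
  have hp2b : (σ ^ 2) ^ 3 ≠ 1 := by rw [← pow_mul]; exact hσ6
  obtain ⟨w2, w6, w22⟩ := aut_order33_unique_type hV A h01 hsymm hdiag hk hsrg (σ ^ 2) hp2 hp2a hp2b (hAk 2)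
  rw [← pow_mul] at w6 w22
  norm_num at w6 w22
  rw [f2] at w2
  rw [f6] at w6
  rw [f22] at w22
  -- σ³ has order 22: seven pairs
  have hp3 : (σ ^ 3) ^ 22 = 1 := by rw [← pow_mul]; exact hσ
  have hp3a : (σ ^ 3) ^ 11 ≠ 1 := by rw [← pow_mul]; exact hσ33
  have hp3b : (σ ^ 3) ^ 2 ≠ 1 := by rw [← pow_mul]; exact hσ6
  obtain ⟨-, o22⟩ := aut_order22_census hV A h01 hsymm hdiag hk hsrg (σ ^ 3) hp3 hp3a hp3b (hAk 3)
  rw [← pow_mul] at o22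
  norm_num at o22
  rw [f3, f33] at o22
  rw [f1, f2, f3, f6, f11, f22, f33]
  clear hAk h2 h6 hD hA hsrg hk hdiag hsymm h01 hσ hp2 hp2a hp2b hp3 hp3a hp3b f1 f2 f3 f6 f11 f22 f33 hσ33 hσ22 hσ6
  norm_num at e2 e3 e6 e11 e22 e33 e66
  have hc1 : c 1 = 1 := by omega
  refine ⟨hc1, w2, w6, w22, ?_⟩
  rcases o22 with ⟨o, o'⟩ | ⟨o, o'⟩ | ⟨o, o'⟩ | ⟨o, o'⟩ | ⟨o, o'⟩ | ⟨o, o'⟩ | ⟨o, o'⟩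
  · exact Or.inl ⟨o, by omega, o'⟩
  · exact Or.inr (Or.inl ⟨o, by omega, o'⟩)
  · exfalso; omega
  · exfalso; omega
  · exfalso; omega
  · exfalso; omega
  · exact Or.inr (Or.inr ⟨o, by omega, o'⟩)

end order66

end Summit.Ventures.DiscreteObjects.Hadamard
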